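import Literature.IUT.HodgeTheaters.BadLocalFrobenioidBiratFromFOfThm34ii
import Literature.AlgebraicGeometry.Frobenioids.BiratUnitsAut
import Literature.AlgebraicGeometry.Frobenioids.BiratUnitsConjugation
import Literature.AlgebraicGeometry.Frobenioids.ModelFrobenioidBiratNormalized
import Literature.AlgebraicGeometry.Frobenioids.UnitTrivializationProp48iiiUnconditional
import Literature.AlgebraicGeometry.Frobenioids.ModelFrobenioidRationalFunctionsProofs
import HarnessLib

/-!
# [IUTchI] Example 3.2 (ii) with `ℱ÷_v := ℱ̲_v^birat` THE [FrdI] §4 birationalization of the [EtTh] tempered Frobenioid: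
# the REAL-birationalization rest input (`TemperedThetaRestBirat`), and (ii) `BiratFromF` UNCONDITIONAL at it —
# at the assembly and AT THE MERGE RECORD (`MergeInputs.ofRestBirat`)

S. Mochizuki, *Inter-universal Teichmüller theory I*, kurims manuscript (May 2020), Example 3.2 (ii) p. 70: «Next, let us recall
the birationalization `ℱ÷_v := ℱ̲_v^birat` [cf. [FrdI], §4]. Write `Ÿ_v → X̲̲_v` for the tempered covering … Thus, we obtain an element
`Θ̲_v ∈ 𝒪^×(T^÷_{Ÿ_v})` … completely determined up to multiplication by a `2l`-th root of unity and the action of the group of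
automorphisms `l·ℤ ⊆ Aut(T_{Ÿ_v})` … the birationalization `ℱ÷_v` may be reconstructed category-theoretically from `ℱ̲_v` [cf. [FrdI],
Corollary 4.10; [EtTh], Proposition 5.1]» [claim: Mochizuki2012, status: disputed] (D-0012 claim key, series status DISPUTED;
DEFINITIONS + proof-only compositions BY NAME; nothing of the series is asserted; no side is taken on [IUTchIII] Cor. 3.12).
S. Mochizuki, *The geometry of Frobenioids I* (2008), Prop. 4.4 (i)(ii)(iv) pp. 82–85 (the birationalization `C → C^birat` over `D`,
`𝒪^×(A^birat)`), Thm. 5.2 (ii) p. 101 (objects of a model Frobenioid are birationally Frobenius-normalized), Def. 4.5 (i) p. 86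
[cite: MochizukiFrdI2008, Prop. 4.4 p.82]; *The étale theta function …* (2009), Def. 3.6 (ii) p. 77 [cite: MochizukiEtTh2009, Def 3.6 p.77].

STATE BEFORE THIS FILE (row «E32ii-BIRAT-REAL» of record, abc-iut-L5-t2 lineage: «the rest-input structure with REAL `ℱ÷_v` … is
DEF-BEARING work of record», p492628 docstring).  In abc-iut-L5-t2's `TemperedThetaRest d T hq C Fbirat` (p444522) the
birationalization side — `ℱ÷_v`, `ℱ̲_v → ℱ÷_v → 𝒟_v`, `𝒪^×(T^÷_{Ÿ_v})` — is free INPUT data; (ii) `BiratFromF` is a theorem only under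
the side condition `hb` («`ℱ÷_v` is (≌) the birationalization», abc-iut-L5-t5 p511072 `biratFromF_frobeniusBadAt_ofRest`), and the
L5 census lists clause (ii)(a) «`ℱ÷_v := ℱ̲_v^birat`» as I(L2/L1).  abc-iut-L1-t3 g14 certified (kernel probe, GAP G-L5-EX32I-1 sub-gap
(b) rewording) that abc-iut-L1's `PreFrobenioid.Birat` / `toBirat` / `biratOps` / `biratOverBase` / `BiratUnits.toAut` instantiate BY
NAME at every [EtTh] Def. 3.6 tempered Frobenioid.

WHAT THIS FILE DOES.
* §1 `BadLocalFrobenioid.temperedBiratUnits_mul_comm` — **`𝒪^×(T^÷_A)` of a tempered Frobenioid IS commutative** (the `unitsTY_comm`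
  law of the L5 interface, here a THEOREM): abc-iut-L1's `BiratUnits.mul_comm_of_isBiratFrobeniusNormalized` ([FrdI] Def. 4.5 (i)) ∘
  `ModelFrobenioid.isBiratFrobeniusNormalizedObj` ([FrdI] Thm. 5.2 (ii)) ∘ abc-iut-L2's `TemperedFrobenioid.objectwise_isGroupLike_weak`;
  divisoriality from `hF`.
* §2 `TemperedThetaRestBirat d T hq C hF` — the INPUT that remains when `ℱ÷_v := Birat C.toElem hF _` IS THE birationalization:
  `Θ̲_v : BiratUnits C.toElem hF T_{Ÿ_v}` (an element of the REAL `𝒪^×(T^÷_{Ÿ_v})`), `l·ℤ ⊆ Aut(T_{Ÿ_v})`, the constants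
  `𝒪^×_{K_v} → 𝒪^×(T^÷_{Ÿ_v})`, `𝒞⊢_v → 𝒞_v` faithful over `𝒟⊢_v ⊆ 𝒟_v`, `𝒞^Θ_v ⊆ ℱ÷_v` faithful over `𝒟^Θ_v → 𝒟_v`; and
  `TemperedThetaRestBirat.toRest : TemperedThetaRest d T hq C (Birat …)` with `birat := toBirat`, `biratBase := (biratOps …).base`,
  `birat_base := biratOverBase` (ON THE NOSE), `unitsTY := (BiratUnits.toAut _).range` (REAL `𝒪^×`, commutative by §1),
  `theta := toAut Θ̲_v`; read-outs `toRest_birat` (rfl), `toRest_birat_equiv` (the `hb` of p511072 holds BY CONSTRUCTION).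
* §3 `BadLocalFrobenioid.biratFromF_ofKits_toRestBirat` — **(ii) `BiratFromF` at the assembly `ofKits … R.toRest.toInput` with NO side
  condition** (binders = the DATA `C`, `hF`, `R` only): p511072 `biratFromF_ofKits_of_birat_eq_toBirat'` at `hb := rfl`.
* §4 AT THE MERGE RECORD: `InitialThetaData.BadTemperedRestBirat B x hx T` (⟨`D₀`, `T′`, `VD`, `Fr`, `hF`, `R : TemperedThetaRestBirat …`⟩),
  `BadTemperedRestBirat.toRest : D.BadTemperedRest B x hx T`, `MergeInputs.ofRestBirat`, and
  **`biratFromF_frobeniusBadAt_ofRestBirat : (D.frobeniusBadAt B (MergeInputs.ofRestBirat …) x hx).BiratFromF` for EVERY index and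
  EVERY REAL-birationalization rest input — residual binders NONE** (p511072 `biratFromF_frobeniusBadAt_ofRest` at `hb` := by construction);
  joint `ex32_ii_iii_frobeniusBadAt_ofRestBirat` = (ii) ∧ (iii) modulo the (iii) bundle {`hnd`, `hds`, `h5`, `hR`} only (`hF` is DATA here).
BINDER CENSUS of §4: {`D`, `B`, `m2`, `Rb`, `m4`, `geomTFG`, `x`, `hx`}; FACT unnamed 0; LAW 0; no instance, no notation, no attribute
change, no `sorry`.  HONEST LABEL: `TemperedThetaRestBirat` / `BadTemperedRestBirat` are INPUT structures of the L2 lane — nothing asserts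
they are inhabited by the [EtTh] §5 objects of the actual Tate curve (GAP G-L5-EX32I-1 / FOUNDATIONS-BOUNDARY HOLD on Ex. 3.2 (i) stand;
sub-gap (a) «`𝒞⊢_v → 𝒞_v` faithful is unsatisfiable at the tower/skeleton models of record» applies verbatim to the field `CdashToC`);
the gain is that clause (ii)(a) «`ℱ÷_v := ℱ̲_v^birat`» and `𝒪^×(T^÷_{Ÿ_v})` are REAL (constructed, [FrdI] §4) for this input class and
(ii)(b) `BiratFromF` needs no law at all.  typed ≠ inhabited ≠ proved.
-/

noncomputable section

namespace Literature.IUT.HodgeTheaters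

open CategoryTheory Opposite Literature.AnabelianGeometry.SemiGraphs Literature.AlgebraicGeometry.Frobenioids
open Literature.AlgebraicGeometry.Frobenioids.PadicFrd Literature.AnabelianGeometry.EtaleTheta Topology

universe u₀ v₀ u v w

/-! ### §1 `𝒪^×(T^÷_A)` of a tempered Frobenioid is commutative ([FrdI] Thm. 5.2 (ii) + Def. 4.5 (i)) -/

namespace BadLocalFrobenioid

section UnitsComm

variable {D₀ : Type u₀} [Category.{v₀} D₀] {T' : RealifiedDivisorMonoids (D₀ := D₀) treeMonoidVocabWeak.{w}}
  {Dv : Type u} [Category.{v} Dv] {VD : FrdICatStub.{u, v, w} Dv}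

/-- **`𝒪^×(A^birat)` is commutative for every object `A` of an [EtTh] Def. 3.6 tempered Frobenioid which is a Frobenioid** (`hF`):
the object is birationally Frobenius-normalized ([FrdI] Thm. 5.2 (ii), abc-iut-L1's `ModelFrobenioid.isBiratFrobeniusNormalizedObj`;
`B = C.ratFnFunctor` group-like by abc-iut-L2's `objectwise_isGroupLike_weak`, `Φ` integral because divisorial by `hF`), and birational
Frobenius-normalization makes `𝒪^×(A^birat)` abelian (abc-iut-L1's `BiratUnits.mul_comm_of_isBiratFrobeniusNormalized`).
[cite: MochizukiFrdI2008, Thm. 5.2 (ii) p.101] -/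
theorem temperedBiratUnits_mul_comm (C : TemperedFrobenioid T' Dv VD) (hF : PreFrobenioid.IsFrobenioid C.toElem)
    (A : C.category) (x y : PreFrobenioid.BiratUnits C.toElem hF A) : x * y = y * x :=
  PreFrobenioid.BiratUnits.mul_comm_of_isBiratFrobeniusNormalized
    (hsq := PreFrobenioid.hasBiratSquares_of_isFrobenioid hF)
    (PreFrobenioid.Birat.isBiratFrobeniusNormalized_of_obj hF _ A
      (ModelFrobenioid.isBiratFrobeniusNormalizedObj C.divisorMonoid C.ratFnFunctor C.divBNatTrans hF _
        (fun X => isIntegral_iff_isCancelMul.mp (hF.isPreFrobenioid.isDivisorial X).isPreDivisorial.isIntegral)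
        C.objectwise_isGroupLike_weak A)) x y

end UnitsComm

end BadLocalFrobenioid

/-! ### §2 The REAL-birationalization rest input -/

/-- **INPUT remaining when `ℱ̲_v` IS an [EtTh] Def. 3.6 tempered Frobenioid `C` over `𝒟_v` AND `ℱ÷_v := ℱ̲_v^birat` IS abc-iut-L1's
[FrdI] §4 birationalization `Birat C.toElem hF _`** ([IUTchI] Ex. 3.2 (ii) «`ℱ÷_v := ℱ̲_v^birat` [cf. [FrdI], §4]»): (ii) `Θ̲_v`, an element
of the REAL unit group `𝒪^×(T^÷_{Ÿ_v}) = BiratUnits C.toElem hF T_{Ÿ_v}` (`T_{Ÿ_v} = (Ÿ_v, 0)`), `l·ℤ ⊆ Aut(T_{Ÿ_v})`; (v) the constants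
`𝒪^×_{K_v} → 𝒪^×(T^÷_{Ÿ_v})`; (iv) `𝒞⊢_v → 𝒞_v = C^{bs-fld}` faithful over `𝒟⊢_v ⊆ 𝒟_v`; (v) `𝒞^Θ_v ⊆ ℱ÷_v` faithful over `𝒟^Θ_v → 𝒟_v`.
Interface DATA of the L2 lane, never asserted. ([IUTchI] Ex 3.2 (ii) p.70) [claim: Mochizuki2012, status: disputed] -/
structure TemperedThetaRestBirat {p : ℕ} [Fact p.Prime] (d : GaloisValDatum.{0} p) {P : Type} [Group P]
    [TopologicalSpace P] (T : BadLocalGroupDatum d.Gal P) {qroot : intNonzero d.k} (hq : ¬ IsUnit qroot)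
    {D₀ : Type u₀} [Category.{v₀} D₀] {T' : RealifiedDivisorMonoids (D₀ := D₀) treeMonoidVocabWeak.{0}}
    {VD : FrdICatStub.{0, 0, 0} T.Dv} (C : TemperedFrobenioid T' T.Dv VD) (hF : PreFrobenioid.IsFrobenioid C.toElem) where
  /-- (ii) `Θ̲_v ∈ 𝒪^×(T^÷_{Ÿ_v})` — an element of the REAL unit group of the birational Frobenius-trivial object over `Ÿ_v` -/
  theta : PreFrobenioid.BiratUnits C.toElem hF (⟨T.ydd, 1⟩ : C.category)
  /-- (ii) `l·ℤ ⊆ Aut(T_{Ÿ_v})` -/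
  lZ : Subgroup (Aut (⟨T.ydd, 1⟩ : C.category))
  /-- (v) the constants `𝒪^×_{K_v} → 𝒪^×(T^÷_{Ÿ_v})` -/
  constUnits : (intNonzero d.k)ˣ →* PreFrobenioid.BiratUnits C.toElem hF (⟨T.ydd, 1⟩ : C.category)
  /-- (iv) `𝒞⊢_v → 𝒞_v = C^{bs-fld}` … -/
  CdashToC : d.Cdash hq ⥤ C.hullCategory
  /-- … faithful … -/
  CdashToC_faithful : CdashToC.Faithful
  /-- … over `𝒟⊢_v ⊆ 𝒟_v` -/
  CdashToC_base : Nonempty (CdashToC ⋙ C.hull ⋙ C.baseFunctorOfCategory ≅ d.CdashBase hq ⋙ T.incl)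
  /-- (v) `𝒞^Θ_v ⊆ ℱ÷_v = ℱ̲_v^birat` … -/
  CThetaToBirat : T.CTheta d hq ⥤ PreFrobenioid.Birat C.toElem hF (PreFrobenioid.hasBiratSquares_of_isFrobenioid hF)
  /-- … faithful … -/
  CThetaToBirat_faithful : CThetaToBirat.Faithful
  /-- … over `𝒟^Θ_v ⊆ (𝒟_v)_{Ÿ_v} → 𝒟_v` (the base functor of `ℱ̲_v^birat` is that of [FrdI] Prop. 4.4 (i)) -/
  CThetaToBirat_base : Nonempty
    (CThetaToBirat ⋙ (PreFrobenioid.biratOps hF (PreFrobenioid.hasBiratSquares_of_isFrobenioid hF)).base ≅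
      T.CThetaBase d hq ⋙ T.dThetaIncl ⋙ Over.forget T.ydd)

namespace TemperedThetaRestBirat

variable {p : ℕ} [Fact p.Prime] {d : GaloisValDatum.{0} p} {P : Type} [Group P] [TopologicalSpace P]
  {T : BadLocalGroupDatum d.Gal P} {qroot : intNonzero d.k} {hq : ¬ IsUnit qroot}
  {D₀ : Type u₀} [Category.{v₀} D₀] {T' : RealifiedDivisorMonoids (D₀ := D₀) treeMonoidVocabWeak.{0}}
  {VD : FrdICatStub.{0, 0, 0} T.Dv} {C : TemperedFrobenioid T' T.Dv VD} {hF : PreFrobenioid.IsFrobenioid C.toElem}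
  (R : TemperedThetaRestBirat d T hq C hF)

/-- **The rest input of abc-iut-L5-t2's `TemperedThetaRest` determined by a REAL-birationalization rest input**: `ℱ̲_v → ℱ÷_v := toBirat`
([FrdI] Prop. 4.4 (i)), `ℱ÷_v → 𝒟_v :=` the base of `(ℱ̲_v^birat → F_{0_D})`, compatibility `biratOverBase` ON THE NOSE,
`𝒪^×(T^÷_{Ÿ_v}) :=` the image of the REAL `BiratUnits … T_{Ÿ_v} ↪ Aut(T^÷_{Ÿ_v})` ([FrdI] Prop. 4.4 (iv)), commutative by §1, `Θ̲_v := toAut Θ̲_v`.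
([IUTchI] Ex 3.2 (ii) p.70) [claim: Mochizuki2012, status: disputed] -/
def toRest : TemperedThetaRest d T hq C (PreFrobenioid.Birat C.toElem hF (PreFrobenioid.hasBiratSquares_of_isFrobenioid hF)) where
  birat := PreFrobenioid.toBirat C.toElem hF _
  biratBase := (PreFrobenioid.biratOps hF (PreFrobenioid.hasBiratSquares_of_isFrobenioid hF)).base
  birat_base := ⟨PreFrobenioid.biratOverBase hF _⟩
  unitsTY := (PreFrobenioid.BiratUnits.toAut (PreFrobenioid.hasBiratSquares_of_isFrobenioid hF) :
    PreFrobenioid.BiratUnits C.toElem hF (⟨T.ydd, 1⟩ : C.category) →* _).range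
  unitsTY_comm := by
    rintro _ ⟨u, rfl⟩ _ ⟨u', rfl⟩
    rw [← map_mul, ← map_mul, BadLocalFrobenioid.temperedBiratUnits_mul_comm C hF _ u u']
  theta := PreFrobenioid.BiratUnits.toAut _ R.theta
  theta_mem := ⟨R.theta, rfl⟩
  lZ := R.lZ
  constUnits := (PreFrobenioid.BiratUnits.toAut (PreFrobenioid.hasBiratSquares_of_isFrobenioid hF) :
    PreFrobenioid.BiratUnits C.toElem hF (⟨T.ydd, 1⟩ : C.category) →* _).rangeRestrict.comp R.constUnits
  CdashToC := R.CdashToC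
  CdashToC_faithful := R.CdashToC_faithful
  CdashToC_base := R.CdashToC_base
  CThetaToBirat := R.CThetaToBirat
  CThetaToBirat_faithful := R.CThetaToBirat_faithful
  CThetaToBirat_base := R.CThetaToBirat_base

/-- `ℱ̲_v → ℱ÷_v` of `toRest` IS the natural functor `toBirat` ([FrdI] Prop. 4.4 (i)). ([IUTchI] Ex 3.2 (ii) p.70) [claim: Mochizuki2012, status: disputed] -/
theorem toRest_birat : R.toRest.birat = PreFrobenioid.toBirat C.toElem hF (PreFrobenioid.hasBiratSquares_of_isFrobenioid hF) := rfl

/-- `𝒪^×(T^÷_{Ÿ_v})` of `toRest` IS the image of the REAL unit group `BiratUnits … T_{Ÿ_v}` in `Aut(T^÷_{Ÿ_v})` ([FrdI] Prop. 4.4 (iv)).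
([IUTchI] Ex 3.2 (ii) p.70) [claim: Mochizuki2012, status: disputed] -/
theorem toRest_unitsTY : R.toRest.unitsTY = (PreFrobenioid.BiratUnits.toAut (PreFrobenioid.hasBiratSquares_of_isFrobenioid hF) :
    PreFrobenioid.BiratUnits C.toElem hF (⟨T.ydd, 1⟩ : C.category) →* _).range := rfl

/-- `Θ̲_v` of `toRest` IS `toAut Θ̲_v`. ([IUTchI] Ex 3.2 (ii) p.70) [claim: Mochizuki2012, status: disputed] -/
theorem toRest_theta : R.toRest.theta = PreFrobenioid.BiratUnits.toAut _ R.theta := rfl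

/-- **The side condition `hb` of p511072 HOLDS BY CONSTRUCTION**: `ℱ÷_v` of `toRest` is (≌, by the identity) the birationalization,
compatibly with `ℱ̲_v → ℱ÷_v`. ([IUTchI] Ex 3.2 (ii) p.70) [claim: Mochizuki2012, status: disputed] -/
theorem toRest_birat_equiv :
    ∃ Φ : PreFrobenioid.Birat C.toElem hF (PreFrobenioid.hasBiratSquares_of_isFrobenioid hF) ≌
        PreFrobenioid.Birat C.toElem hF (PreFrobenioid.hasBiratSquares_of_isFrobenioid hF),
      Nonempty (R.toRest.toInput.birat ⋙ Φ.functor ≅ PreFrobenioid.toBirat C.toElem hF _) :=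
  ⟨CategoryTheory.Equivalence.refl, ⟨Functor.rightUnitor _⟩⟩

end TemperedThetaRestBirat

/-! ### §3 (ii) `BiratFromF` at the assembly over a REAL-birationalization rest input — no side condition -/

namespace BadLocalFrobenioid

variable {p : ℕ} [Fact p.Prime] (l : ℕ) (d : GaloisValDatum.{0} p) {P : Type} [Group P] [TopologicalSpace P]
  [IsTopologicalGroup P] (T : BadLocalGroupDatum d.Gal P) (q qroot : intNonzero d.k) (hpow : qroot ^ (2 * l) = q)
  (hq : ¬ IsUnit qroot) {D₀ : Type u₀} [Category.{v₀} D₀]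
  {T' : RealifiedDivisorMonoids (D₀ := D₀) treeMonoidVocabWeak.{0}} {VD : FrdICatStub.{0, 0, 0} T.Dv}

/-- **[IUTchI] Ex. 3.2 (ii) `BiratFromF` at `ofKits` over a REAL-birationalization rest input — binders = the DATA only**
(`C`, `hF`, `R`): p511072 `biratFromF_ofKits_of_birat_eq_toBirat'` at `hb := rfl` ([FrdI] Cor. 4.10 with Thm. 3.4 (ii) a theorem).
([IUTchI] Ex 3.2 (ii) p.70) [claim: Mochizuki2012, status: disputed] -/
theorem biratFromF_ofKits_toRestBirat (C : TemperedFrobenioid T' T.Dv VD) (hF : PreFrobenioid.IsFrobenioid C.toElem)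
    (R : TemperedThetaRestBirat d T hq C hF) :
    (ofKits l d T q qroot hpow hq R.toRest.toInput).BiratFromF :=
  biratFromF_ofKits_of_birat_eq_toBirat' l d T q qroot hpow hq C hF _ R.toRest.toInput rfl

end BadLocalFrobenioid

/-! ### §4 AT THE MERGE RECORD: `BadTemperedRestBirat`, `MergeInputs.ofRestBirat`, (ii) UNCONDITIONAL -/

section MergeRecord

open _root_.NumberField _root_.IsDedekindDomain

variable {F K Fbar : Type} [Field F] [NumberField F] [Field K] [NumberField K] [Algebra F K]
  [Field Fbar] [Algebra F Fbar] [Algebra K Fbar] {E : WeierstrassCurve F}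
  [E.IsElliptic] {l : ℕ} {Pb : BadPlacePredicates K} (D : InitialThetaData F K Fbar E l Pb)
  (B : ∀ v, v ∈ D.indexCopyBad → D.BadPairAt v)

namespace InitialThetaData

/-- **(m1) as an [EtTh] Def. 3.6 tempered Frobenioid WHICH IS A FROBENIOID + a REAL-birationalization rest input at a bad index**:
`D₀`, `T′`, `VD`, `Fr` as in `BadTemperedRest` (p498213), `hF` ([FrdI] Thm. 5.2 (ii) at `Fr`, now DATA), and `R : TemperedThetaRestBirat …`
(`ℱ÷_v := Birat Fr.toElem hF _`).  Interface DATA of the L2 lane, never asserted. ([IUTchI] Ex 3.2 (i)(ii) p.70) [claim: Mochizuki2012, status: disputed] -/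
structure BadTemperedRestBirat (x : D.IndexCopy) (hx : x ∈ D.indexCopyBad)
    (T : BadLocalGroupDatum (D.GalAt x (D.not_mem_arc_of_mem_bad hx)) ↥(B x hx).H) : Type (max 1 (u₀ + 1)) where
  /-- the base of the realified divisor-monoid data ([EtTh] §3 input) -/
  D₀ : Type u₀
  /-- its category structure -/
  [catD₀ : Category.{u₀} D₀]
  /-- the realified divisor monoids ([EtTh] §3 input, weak [FrdI] vocabulary) -/
  T' : RealifiedDivisorMonoids (D₀ := D₀) treeMonoidVocabWeak.{0}
  /-- the [FrdI] category data over `𝒟_v = CosetCat Π_{X̳̲_v̲}` -/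
  VD : FrdICatStub.{0, 0, 0} T.Dv
  /-- the [EtTh] Def. 3.6 tempered Frobenioid `ℱ̲_v` over `𝒟_v` … -/
  Fr : TemperedFrobenioid T' T.Dv VD
  /-- … which is a Frobenioid ([FrdI] Thm. 5.2 (ii)) -/
  hF : PreFrobenioid.IsFrobenioid Fr.toElem
  /-- the REAL-birationalization rest input over `Fr` -/
  R : @TemperedThetaRestBirat _ (D.fact_primeAt_prime x (D.not_mem_arc_of_mem_bad hx)) (D.gvdAt x _) _ _ _ T
    (D.qRootAtIdx x hx) (D.qRootAtIdx_not_isUnit x hx) D₀ catD₀ T' VD Fr hF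

namespace BadTemperedRestBirat

variable {D B} {x : D.IndexCopy} {hx : x ∈ D.indexCopyBad}
  {T : BadLocalGroupDatum (D.GalAt x (D.not_mem_arc_of_mem_bad hx)) ↥(B x hx).H} (Rb : D.BadTemperedRestBirat B x hx T)

/-- **The `BadTemperedRest` (p498213) of a REAL-birationalization rest input**: `ℱ÷_v := Birat Fr.toElem hF _`, `R := Rb.R.toRest`.
([IUTchI] Ex 3.2 (i)(ii) p.70) [claim: Mochizuki2012, status: disputed] -/
def toRest : D.BadTemperedRest B x hx T :=
  haveI := D.fact_primeAt_prime x (D.not_mem_arc_of_mem_bad hx)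
  letI := Rb.catD₀
  { D₀ := Rb.D₀, T' := Rb.T', VD := Rb.VD, Fr := Rb.Fr
    Fbirat := PreFrobenioid.Birat Rb.Fr.toElem Rb.hF (PreFrobenioid.hasBiratSquares_of_isFrobenioid Rb.hF)
    R := Rb.R.toRest }

/-- Its tempered Frobenioid IS `Rb.Fr` and its `ℱ÷_v` IS the birationalization. ([IUTchI] Ex 3.2 (ii) p.70) [claim: Mochizuki2012, status: disputed] -/
theorem toRest_Fr : Rb.toRest.Fr = Rb.Fr ∧
    Rb.toRest.Fbirat = (letI := Rb.catD₀
      PreFrobenioid.Birat Rb.Fr.toElem Rb.hF (PreFrobenioid.hasBiratSquares_of_isFrobenioid Rb.hF)) :=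
  ⟨rfl, rfl⟩

end BadTemperedRestBirat

variable (m2 : ∀ x (hx : x ∈ D.indexCopyBad), BadLocalGroupDatum (D.GalAt x (D.not_mem_arc_of_mem_bad hx)) ↥(B x hx).H)
  (Rb : ∀ x (hx : x ∈ D.indexCopyBad), D.BadTemperedRestBirat B x hx (m2 x hx)) (m4 : RealifiedGlobalSide)
  (geomTFG : D.geom.extF.GeomTFG)

/-- **The merge record whose (m1) IS a tempered Frobenioid with `ℱ÷_v` ITS birationalization at every bad index.**
([IUTchI] Ex 3.2 (i)(ii) p.70) [claim: Mochizuki2012, status: disputed] -/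
def MergeInputs.ofRestBirat : D.MergeInputs B :=
  MergeInputs.ofRest D B m2 (fun x hx => (Rb x hx).toRest) m4 geomTFG

/-- It IS `ofRest` at the rest family `fun x hx => (Rb x hx).toRest`. ([IUTchI] Ex 3.2 (i) p.70) [claim: Mochizuki2012, status: disputed] -/
theorem MergeInputs.ofRestBirat_eq :
    MergeInputs.ofRestBirat D B m2 Rb m4 geomTFG = MergeInputs.ofRest D B m2 (fun x hx => (Rb x hx).toRest) m4 geomTFG := rfl

variable (x : D.IndexCopy) (hx : x ∈ D.indexCopyBad)

/-- **[IUTchI] Ex. 3.2 (ii) AT THE MERGE RECORD over REAL-birationalization rest inputs — NO residual binder**: «`ℱ÷_v := ℱ̲_v^birat` may be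
reconstructed category-theoretically from `ℱ̲_v`» (`BiratFromF`) HOLDS at `frobeniusBadAt B (MergeInputs.ofRestBirat …) x hx` for EVERY
index and EVERY input: p511072 `biratFromF_frobeniusBadAt_ofRest` with `hF` the datum's own and `hb` by construction (`toRest_birat_equiv`).
([IUTchI] Ex 3.2 (ii) p.70) [claim: Mochizuki2012, status: disputed] -/
theorem biratFromF_frobeniusBadAt_ofRestBirat [Fact (D.primeAt x (D.not_mem_arc_of_mem_bad hx)).Prime] :
    (D.frobeniusBadAt B (MergeInputs.ofRestBirat D B m2 Rb m4 geomTFG) x hx).BiratFromF :=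
  letI := (Rb x hx).catD₀
  D.biratFromF_frobeniusBadAt_ofRest B m2 (fun x hx => (Rb x hx).toRest) m4 geomTFG x hx (Rb x hx).hF
    (Rb x hx).R.toRest_birat_equiv

/-- **[IUTchI] Ex. 3.2 (ii) ∧ (iii) JOINTLY at the merge record over REAL-birationalization rest inputs**: (ii) UNCONDITIONAL, (iii) modulo
the [EtTh] Cor. 3.8 (ii) bundle {`hnd`, `hds`, `h5`, `hR`} on `Fr` (`hF` is the datum's own; p498213 `cFromF_frobeniusBadAt_ofRest`).
([IUTchI] Ex 3.2 (ii)(iii) pp.70-71) [claim: Mochizuki2012, status: disputed] -/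
theorem ex32_ii_iii_frobeniusBadAt_ofRestBirat [Fact (D.primeAt x (D.not_mem_arc_of_mem_bad hx)).Prime]
    (hnd : letI := (Rb x hx).catD₀
      ∀ (A : (m2 x hx).Dvᵒᵖ) (f : A ⟶ A), treeMonoidVocabWeak.{0}.IsNonDilating ((Rb x hx).Fr.Φ.carrier A) ((Rb x hx).Fr.Φ.pull f))
    (hds : letI := (Rb x hx).catD₀
      ∀ (A : (m2 x hx).Dv) (α : Aut (Over.forget A)),
      (∀ (B' : Over A) (y : (Rb x hx).Fr.divisorMonoid.obj (op B'.left)),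
        Literature.AlgebraicGeometry.Frobenioids.pull (Rb x hx).Fr.divisorMonoid (α.hom.app B') y = y) → α = 1)
    (h5 : letI := (Rb x hx).catD₀; (Rb x hx).Fr.BsFldPreStepLimitCriterion (PreFrobenioidData.perfection (Rb x hx).hF))
    (hR : letI := (Rb x hx).catD₀; (Rb x hx).Fr.Remark363) :
    (D.frobeniusBadAt B (MergeInputs.ofRestBirat D B m2 Rb m4 geomTFG) x hx).BiratFromF ∧
      (D.frobeniusBadAt B (MergeInputs.ofRestBirat D B m2 Rb m4 geomTFG) x hx).CFromF :=
  ⟨D.biratFromF_frobeniusBadAt_ofRestBirat B m2 Rb m4 geomTFG x hx,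
    letI := (Rb x hx).catD₀
    D.cFromF_frobeniusBadAt_ofRest B m2 (fun x hx => (Rb x hx).toRest) m4 geomTFG x hx hnd hds (Rb x hx).hF h5 hR⟩

end InitialThetaData

end MergeRecord

end Literature.IUT.HodgeTheaters

end

/-! ### §5 (append-only v2) `Θ̲_v` FROM A RATIONAL FUNCTION — `B(A) ≃* 𝒪^×(T^÷_A)` ([FrdI] Thm. 5.2 (ii) «Moreover … the rational
function monoid of `𝒞` is naturally isomorphic to `B`», p. 101, abc-iut-L1's `ModelFrobenioid.rationalFunctionMonoidStr` BY NAME, certified at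
tempered Frobenioids by abc-iut-L1-t3 g14's probe) and `TemperedThetaRestBirat.ofRatFn`: the REAL-birationalization rest input fed DIRECTLY by a
rational function `θB ∈ B(Ÿ_v)` (the Θ̈-fraction of the L2 lane, GAP G-L5-EX32I-1 sub-gap (b)), divisor read-out included.  Abbreviations of
abc-iut-L1 objects; no instance, no notation, nothing asserted. -/

noncomputable section

namespace Literature.IUT.HodgeTheaters

open CategoryTheory Opposite Literature.AnabelianGeometry.SemiGraphs Literature.AlgebraicGeometry.Frobenioids
open Literature.AlgebraicGeometry.Frobenioids.PadicFrd Literature.AnabelianGeometry.EtaleTheta Topology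

universe u₀' v₀' u' v' w'

namespace BadLocalFrobenioid

section RatFn

variable {D₀ : Type u₀'} [Category.{v₀'} D₀] {T' : RealifiedDivisorMonoids (D₀ := D₀) treeMonoidVocabWeak.{w'}}
  {Dv : Type u'} [Category.{v'} Dv] {VD : FrdICatStub.{u', v', w'} Dv}

/-- **`B(A) ≃* 𝒪^×(T^÷_A)` for an [EtTh] tempered Frobenioid which is a Frobenioid** — the rational function monoid `B` of [EtTh] Def. 3.6 (ii)
at `A` IS the unit group of the birational Frobenius-trivial object `T_A = (A, 0)`: abc-iut-L1's [FrdI] Thm. 5.2 (ii) «Moreover»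
`ModelFrobenioid.rationalFunctionMonoidStr` (group-likeness of `B` by abc-iut-L2's `objectwise_isGroupLike_weak`, divisoriality from `hF`).
[cite: MochizukiFrdI2008, Thm. 5.2 (ii) p.101] -/
def temperedRatFnEquivBiratUnits (C : TemperedFrobenioid T' Dv VD) (hF : PreFrobenioid.IsFrobenioid C.toElem) (A : Dv) :
    C.ratFnFunctor.obj (op A) ≃* PreFrobenioid.BiratUnits C.toElem hF (⟨A, 1⟩ : C.category) :=
  (ModelFrobenioid.rationalFunctionMonoidStr C.objectwise_isGroupLike_weak hF.isPreFrobenioid.isDivisorial hF).iso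
    (⟨A, 1⟩ : C.category)

/-- **Divisor compatibility**: the birational divisor of the unit attached to `b ∈ B(A)` IS `Div_B b` ([FrdI] Thm. 5.2 (ii) «Moreover»).
[cite: MochizukiFrdI2008, Thm. 5.2 (ii) p.101] -/
theorem divHom_temperedRatFnEquivBiratUnits (C : TemperedFrobenioid T' Dv VD) (hF : PreFrobenioid.IsFrobenioid C.toElem) (A : Dv)
    (b : C.ratFnFunctor.obj (op A)) :
    PreFrobenioid.BiratUnits.divHom hF (⟨A, 1⟩ : C.category) (temperedRatFnEquivBiratUnits C hF A b) =
      (C.divBNatTrans.app (op A)).hom b :=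
  (ModelFrobenioid.rationalFunctionMonoidStr C.objectwise_isGroupLike_weak hF.isPreFrobenioid.isDivisorial hF).div_iso
    (⟨A, 1⟩ : C.category) b

end RatFn
end BadLocalFrobenioid

namespace TemperedThetaRestBirat
variable {p : ℕ} [Fact p.Prime] {d : GaloisValDatum.{0} p} {P : Type} [Group P] [TopologicalSpace P]
  {T : BadLocalGroupDatum d.Gal P} {qroot : intNonzero d.k} {hq : ¬ IsUnit qroot}
  {D₀ : Type u₀'} [Category.{v₀'} D₀] {T' : RealifiedDivisorMonoids (D₀ := D₀) treeMonoidVocabWeak.{0}}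
  {VD : FrdICatStub.{0, 0, 0} T.Dv}

/-- **The REAL-birationalization rest input built from a rational function `θB ∈ B(Ÿ_v)`** (the Θ̈-fraction of the L2 lane) and constants
given as rational functions: `Θ̲_v := (B(Ÿ_v) ≃* 𝒪^×(T^÷_{Ÿ_v})) θB`, constants likewise; the remaining fields as given.
([IUTchI] Ex 3.2 (ii) p.70) [claim: Mochizuki2012, status: disputed] -/
def ofRatFn (C : TemperedFrobenioid T' T.Dv VD) (hF : PreFrobenioid.IsFrobenioid C.toElem)
    (θB : C.ratFnFunctor.obj (op T.ydd)) (lZ : Subgroup (Aut (⟨T.ydd, 1⟩ : C.category)))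
    (cnst : (intNonzero d.k)ˣ →* C.ratFnFunctor.obj (op T.ydd))
    (CdashToC : d.Cdash hq ⥤ C.hullCategory) (hCf : CdashToC.Faithful)
    (hCb : Nonempty (CdashToC ⋙ C.hull ⋙ C.baseFunctorOfCategory ≅ d.CdashBase hq ⋙ T.incl))
    (CThetaToBirat : T.CTheta d hq ⥤ PreFrobenioid.Birat C.toElem hF (PreFrobenioid.hasBiratSquares_of_isFrobenioid hF))
    (hTf : CThetaToBirat.Faithful)
    (hTb : Nonempty (CThetaToBirat ⋙ (PreFrobenioid.biratOps hF (PreFrobenioid.hasBiratSquares_of_isFrobenioid hF)).base ≅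
      T.CThetaBase d hq ⋙ T.dThetaIncl ⋙ Over.forget T.ydd)) :
    TemperedThetaRestBirat d T hq C hF where
  theta := BadLocalFrobenioid.temperedRatFnEquivBiratUnits C hF T.ydd θB
  lZ := lZ
  constUnits := (BadLocalFrobenioid.temperedRatFnEquivBiratUnits C hF T.ydd).toMonoidHom.comp cnst
  CdashToC := CdashToC
  CdashToC_faithful := hCf
  CdashToC_base := hCb
  CThetaToBirat := CThetaToBirat
  CThetaToBirat_faithful := hTf
  CThetaToBirat_base := hTb

/-- `Θ̲_v` of `ofRatFn` IS the unit attached to `θB`, and its birational divisor IS `Div_B θB` ([FrdI] Thm. 5.2 (ii)).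
([IUTchI] Ex 3.2 (ii) p.70) [claim: Mochizuki2012, status: disputed] -/
theorem ofRatFn_theta (C : TemperedFrobenioid T' T.Dv VD) (hF : PreFrobenioid.IsFrobenioid C.toElem)
    (θB : C.ratFnFunctor.obj (op T.ydd)) (lZ : Subgroup (Aut (⟨T.ydd, 1⟩ : C.category)))
    (cnst : (intNonzero d.k)ˣ →* C.ratFnFunctor.obj (op T.ydd))
    (CdashToC : d.Cdash hq ⥤ C.hullCategory) (hCf : CdashToC.Faithful)
    (hCb : Nonempty (CdashToC ⋙ C.hull ⋙ C.baseFunctorOfCategory ≅ d.CdashBase hq ⋙ T.incl))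
    (CThetaToBirat : T.CTheta d hq ⥤ PreFrobenioid.Birat C.toElem hF (PreFrobenioid.hasBiratSquares_of_isFrobenioid hF))
    (hTf : CThetaToBirat.Faithful)
    (hTb : Nonempty (CThetaToBirat ⋙ (PreFrobenioid.biratOps hF (PreFrobenioid.hasBiratSquares_of_isFrobenioid hF)).base ≅
      T.CThetaBase d hq ⋙ T.dThetaIncl ⋙ Over.forget T.ydd)) :
    (ofRatFn C hF θB lZ cnst CdashToC hCf hCb CThetaToBirat hTf hTb).theta =
        BadLocalFrobenioid.temperedRatFnEquivBiratUnits C hF T.ydd θB ∧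
      PreFrobenioid.BiratUnits.divHom hF (⟨T.ydd, 1⟩ : C.category)
          (ofRatFn C hF θB lZ cnst CdashToC hCf hCb CThetaToBirat hTf hTb).theta = (C.divBNatTrans.app (op T.ydd)).hom θB :=
  ⟨rfl, BadLocalFrobenioid.divHom_temperedRatFnEquivBiratUnits C hF T.ydd θB⟩

end TemperedThetaRestBirat

end Literature.IUT.HodgeTheaters

end
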